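import Literature.NumberTheory.Rogawski1990.ArchExplicitTransferFactorCurveDeriv     -- ★ p839618 (F0P3a-p05 (g10)): per-place `χ_g(u)`, `det g`, `t` along ★ B-p12's lifted curve (generic base); brings ★ `ArchSingularCurveNormPair` p839172
import HarnessLib

/-!
# Rogawski's explicit archimedean factor along the CENTRAL one-angle curve at one place `w₀` — the algebra: `χ_g(u)`, `τ`'s argument, `D_{G∕H,∞}` and `κ_w`
# (the central-curve twin of ★ `ArchExplicitTransferFactorCurve*`; Rogawski 1990 §14.5 Lemma 14.5.2 (c) p. 238, §8.2 (8.2.1) p. 123, §4.9 p. 55)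

Topic `NumberTheory/Rogawski1990`; namespace `Literature.NumberTheory.Rogawski1990`.  THEOREMS ONLY (no definition, no named fact, no instance, no notation, no `sorry`).
Cell `pub/hodgecm-mathlib`, ENGINE T1 (crux H413 = `stmt-HodgeConjecture-24833`); floor-1½ preparation, count-neutral, under row (S-c) ∕ `stub_Sc` of the «SdArch» pay-down line:
brick **(R3-d) «CENTRAL-CURVE TWIN»** of F0P3a-p02 (g10)'s R3 census `CENSUS-R3-ScCentralVanishing` 3fa90e6c §2 (LEAD F0P3a-plan (g9) WORD T8-57 (B); author F0P3a-p05 (g11)).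
FILE G1 of two (G2 = `ArchExplicitTransferFactorCentralCurveTau`: `|τ| = 1`, `|∂_ψ τ| ≤ C∕|ψ|`, the assembled `Δ″` bounds).

THE CURVE.  ★ B-p12's lifted curve `(γH, γG)` (`ArchSingularCurveNormPair` p839172; binders VERBATIM, instantiate with `rfl rfl`) at a CENTRAL base at ONE place `w₀`:
only `w₀` moves (`c w₀ ≠ 0`, `c w = 0` for `w ≠ w₀` — the induction step of (M1)∕(M3): the other places sit at FIXED `(G,H)`-regular points), and at `w₀` the base point is CENTRAL,
`z₀ w₀ 0 = z₀ w₀ 1 = z₀ w₀ 2 =: ζ`; so at `w₀`: `a(ψ) = ζe^{icψ}`, `b(ψ) = ζe^{−icψ}`, `u = ζ`, `γ′(ψ)_{w₀} = diag(ζe^{icψ}, ζ, ζe^{−icψ}) → ζ•1`, `g(ψ)_{w₀} → ζ•1₂`.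

WHAT IS PROVED.
* §1 `χ_g(u)` and `τ`'s argument `t = −χ_g(u)·det g⁻¹` at `w₀`: **`evalC_eval_archCharpolyTwo_centralCurve_self`** (`= ζ²(2 − 2cos(cψ)) = 4ζ²sin²(cψ∕2)` — vanishes to order 2 at `ψ = 0`),
  **`evalC_archTauArg_centralCurve_self`** (`= 2cos(cψ) − 2`: REAL, `≤ 0`, `→ 0` — the centre is where `μ_∞` is singular), and off `w₀` (`c w = 0`): `…_of_ne` (the constants
  `(u_w − z₀,w,0)(u_w − z₀,w,2)`, units by `hreg`); `isUnit_archTauArg_centralCurve_of_cos_ne_one`.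
* §2 **`archWeylRatio_centralCurve`**: `D_{G∕H,∞}(γ_H(ψ)) = K · (2 − 2cos(c ψ))`, `K = ∏_{w ≠ w₀} ‖(u_w − z₀,w,0)(u_w − z₀,w,2)‖` (so `D_{G∕H,∞}(0) = 0`, order-2 vanishing; `0 < K` under `hreg`).
* §3 (ANY base and speeds — generic over ★ B-p12's curve, form `diag α`): **`archEigenlineProjector_archSingularCurve`** (`P_w = diag(0, (u_w − a_w)(u_w − b_w), 0)`), and
  **`archKappaAt_archSingularCurve_eq_of_ne_zero`**: `κ_w(γ_H(ψ), γ′(ψ)) = sgn(re σ_w(α 1)) · η_w(diag α)` whenever `(u_w − a_w(ψ))(u_w − b_w(ψ)) ≠ 0` — INDEPENDENT of `ψ` (recovers ★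
  `eventually_prod_archKappaAt_archSingularCurve_eq` without continuity); at the central base: **`prod_archKappaAt_centralCurve_eq_of_cos_ne_one`** (the product is the constant
  `∏_w sgn(re σ_w(α 1))·η_w` for every `ψ` with `cos(c w₀ ψ) ≠ 1`; at `ψ = 0` itself `κ_{w₀} = 0`).
HONEST LABEL: HC_CM is proved only modulo the printed citations until rung 0 closes; this file is algebra along a curve and pays nothing by itself.

## References
* [Rogawski1990] J. D. Rogawski, *Automorphic Representations of Unitary Groups in Three Variables*, Ann. of Math. Stud. 123 (1990): §14.5 Lemma 14.5.2 (c) and p. 238 (the approach to the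
  centre, «the limit formula for `H` implies `f′^H_v(γ₀) = 0`»), §8.2 (8.2.1) p. 123, §8.4 pp. 126–127, §4.9 p. 55 (`τ`, `D_{G∕H}`), §14.6 p. 242 (`κ = ±1`).
* [LanglandsShelstad1987] R. P. Langlands, D. Shelstad, *On the definition of transfer factors*, Math. Ann. 278 (1987), §2, Lemma 4.1.A.
-/

set_option autoImplicit false

noncomputable section

open NumberField NumberField.InfinitePlace Matrix Polynomial Filter Topology Complex
open scoped MatrixGroups ComplexConjugate

namespace Literature.NumberTheory.Rogawski1990

open Literature.NumberTheory.Automorphic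
open Literature.NumberTheory.GaloisRepresentations

/-! ## §0 Two trigonometric identities (private) -/

/-- `(ζ − ζe^{ix})(ζ − ζe^{−ix}) = ζ²(2 − 2cos x)`. [folklore] -/
private theorem central_charpoly_trig (ζ : ℂ) (x : ℝ) :
    (ζ - ζ * cexp ((x : ℂ) * I)) * (ζ - ζ * cexp (-(x : ℂ) * I)) = ζ ^ 2 * (2 - 2 * (Real.cos x : ℂ)) := by
  have hE : cexp ((x : ℂ) * I) * cexp (-(x : ℂ) * I) = 1 := by
    rw [← Complex.exp_add, neg_mul, add_neg_cancel, Complex.exp_zero]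
  have h2 := Complex.two_cos (x : ℂ)
  rw [Complex.ofReal_cos]
  linear_combination ζ ^ 2 * hE + ζ ^ 2 * h2

/-- `ζe^{ix} · ζe^{−ix} = ζ²`. [folklore] -/
private theorem central_det_trig (ζ : ℂ) (x : ℝ) : ζ * cexp ((x : ℂ) * I) * (ζ * cexp (-(x : ℂ) * I)) = ζ ^ 2 := by
  have hE : cexp ((x : ℂ) * I) * cexp (-(x : ℂ) * I) = 1 := by
    rw [← Complex.exp_add, neg_mul, add_neg_cancel, Complex.exp_zero]
  linear_combination ζ ^ 2 * hE

/-- A CM field has no real place, so an element of `L ⊗ ℝ` with every complex coordinate non-zero is a unit. [folklore] -/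
private theorem isUnit_mixedSpace_of_forall_evalC_ne_zero {L : Type} [Field L] [NumberField L] [IsCMField L] {x : mixedEmbedding.mixedSpace L}
    (h : ∀ w : {w : InfinitePlace L // IsComplex w}, UnitaryGroup.evalC L w x ≠ 0) : IsUnit x := by
  haveI := UnitaryGroup.isEmpty_isReal (↥(maximalRealSubfield L)) L (IsCMField.complexConj L) (IsCMField.complexConj_ne_one L)
    (UnitaryGroup.complexConj_smul_infinitePlace L)
  rw [Prod.isUnit_iff, Pi.isUnit_iff, Pi.isUnit_iff]
  exact ⟨fun v => isEmptyElim v, fun w => isUnit_iff_ne_zero.2 (h w)⟩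

section Curve

variable (L : Type) [Field L] [NumberField L] [IsCMField L] (α : Fin 3 → L)
  (z₀ : {w : InfinitePlace L // IsComplex w} → Fin 3 → Circle) (c : {w : InfinitePlace L // IsComplex w} → ℝ)
  (γH : ℝ →
    ↥(UnitaryGroup.arch (↥(maximalRealSubfield L)) L (IsCMField.complexConj L) 2
        (Matrix.of fun i j : Fin 2 => if i.val + j.val + 1 = 2 then (1 : L) else 0)) ×
      ↥(UnitaryGroup.arch (↥(maximalRealSubfield L)) L (IsCMField.complexConj L) 1
        (Matrix.of fun i j : Fin 1 => if i.val + j.val + 1 = 1 then (1 : L) else 0)))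
  (γG : ℝ → ↥(UnitaryGroup.arch (↥(maximalRealSubfield L)) L (IsCMField.complexConj L) 3 (Matrix.diagonal α)))
  (hγH : γH = fun ψ =>
    ((UnitaryGroup.archPiEquivCM 2 L (Matrix.of fun i j : Fin 2 => if i.val + j.val + 1 = 2 then (1 : L) else 0)).symm fun w =>
        ⟨Matrix.GeneralLinearGroup.mkOfDetNeZero !![(1 : ℂ), 1; 1, -1] UnitaryGroup.det_cayleyTwo_ne_zero *
            UnitaryGroup.circleDiagonal 2 ![z₀ w 0 * Circle.exp (![(1 : ℝ), 0, -1] 0 * (c w * ψ)), z₀ w 2 * Circle.exp (![(1 : ℝ), 0, -1] 2 * (c w * ψ))] *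
          (Matrix.GeneralLinearGroup.mkOfDetNeZero !![(1 : ℂ), 1; 1, -1] UnitaryGroup.det_cayleyTwo_ne_zero)⁻¹,
          UnitaryGroup.cayley_conj_circleDiagonal_mem_archLocal L w _⟩,
      (UnitaryGroup.archPiEquivCM 1 L (Matrix.of fun i j : Fin 1 => if i.val + j.val + 1 = 1 then (1 : L) else 0)).symm fun w =>
        ⟨UnitaryGroup.circleDiagonal 1 ![z₀ w 1 * Circle.exp (![(1 : ℝ), 0, -1] 1 * (c w * ψ))],
          UnitaryGroup.circleDiagonal_mem_archLocal_antidiagOne L w _⟩))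
  (hγG : γG = fun ψ => UnitaryGroup.archDiagTorus L 3 α fun w i => z₀ w i * Circle.exp (![(1 : ℝ), 0, -1] i * (c w * ψ)))

  (w₀ : {w : InfinitePlace L // IsComplex w})

/-! ## §1 `χ_g(u)` and `τ`'s argument along the central curve -/

include hγH in
/-- **AT THE MOVING PLACE `w₀` (central base): `σ_{w₀}(χ_{g(ψ)}(u)) = ζ²·(2 − 2cos(c_{w₀}ψ))`** (`= 4ζ² sin²(cψ∕2)`, `ζ = z₀ w₀ 1`; ★ `evalC_eval_archCharpolyTwo_archSingularCurveH` at `a = ζe^{icψ}`,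
`b = ζe^{−icψ}`, `u = ζ`).  Vanishes to order two at `ψ = 0`. [cite: Rogawski1990, §14.5 p. 238; §4.9 p. 55] -/
theorem evalC_eval_archCharpolyTwo_centralCurve_self (hcen : z₀ w₀ 0 = z₀ w₀ 1 ∧ z₀ w₀ 2 = z₀ w₀ 1) (ψ : ℝ) :
    UnitaryGroup.evalC L w₀ ((archCharpolyTwo L (γH ψ)).eval (archGammaTwo L (γH ψ))) =
      (z₀ w₀ 1 : ℂ) ^ 2 * (2 - 2 * (Real.cos (c w₀ * ψ) : ℂ)) := by
  rw [evalC_eval_archCharpolyTwo_archSingularCurveH L z₀ c γH hγH ψ w₀, hcen.1, hcen.2]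
  simp only [Matrix.cons_val_zero, Matrix.cons_val_two, Matrix.tail_cons, Matrix.head_cons, one_mul, Circle.coe_mul, Circle.coe_exp,
    Complex.ofReal_neg, neg_mul]
  have h := central_charpoly_trig (z₀ w₀ 1 : ℂ) (c w₀ * ψ)
  rw [neg_mul] at h
  exact h

include hγH in
/-- **AT A FIXED PLACE `w ≠ w₀`** (`c w = 0`): `σ_w(χ_{g(ψ)}(u)) = (u_w − z₀,w,0)(u_w − z₀,w,2)` — constant in `ψ`. [cite: Rogawski1990, §4.9 p. 55] -/
theorem evalC_eval_archCharpolyTwo_centralCurve_of_ne (hc : ∀ w, w ≠ w₀ → c w = 0) (ψ : ℝ) {w : {w : InfinitePlace L // IsComplex w}} (hw : w ≠ w₀) :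
    UnitaryGroup.evalC L w ((archCharpolyTwo L (γH ψ)).eval (archGammaTwo L (γH ψ))) = ((z₀ w 1 : ℂ) - z₀ w 0) * ((z₀ w 1 : ℂ) - z₀ w 2) := by
  rw [evalC_eval_archCharpolyTwo_archSingularCurveH L z₀ c γH hγH ψ w, hc w hw]
  simp only [zero_mul, mul_zero, Circle.exp_zero, mul_one]

include hγH in
/-- **`σ_{w₀}(t(ψ)) = 2cos(c_{w₀}ψ) − 2`** for `τ`'s argument `t = −χ_g(u)·det g⁻¹` at the central base (`det g(ψ)_{w₀} = ζ²`): REAL, `≤ 0`, and `→ 0` as `ψ → 0` — at the centre `μ_∞` is read at a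
NON-UNIT, which is why `τ` has no limit there but `|τ| = 1` and `|∂τ| ≤ C∕|ψ|` (FILE G2). [cite: Rogawski1990, §14.5 p. 238; §4.9 p. 55] -/
theorem evalC_archTauArg_centralCurve_self (hcen : z₀ w₀ 0 = z₀ w₀ 1 ∧ z₀ w₀ 2 = z₀ w₀ 1) (ψ : ℝ) :
    UnitaryGroup.evalC L w₀ (archTauArg L (γH ψ)) = 2 * (Real.cos (c w₀ * ψ) : ℂ) - 2 := by
  rw [evalC_archTauArg_archSingularCurveH L z₀ c γH hγH ψ w₀, hcen.1, hcen.2]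
  simp only [Matrix.cons_val_zero, Matrix.cons_val_two, Matrix.tail_cons, Matrix.head_cons, one_mul, Circle.coe_mul, Circle.coe_exp,
    Complex.ofReal_neg, neg_mul]
  have h1 := central_charpoly_trig (z₀ w₀ 1 : ℂ) (c w₀ * ψ)
  have h2 := central_det_trig (z₀ w₀ 1 : ℂ) (c w₀ * ψ)
  rw [neg_mul] at h1 h2
  rw [h1, h2]
  have hζ : (z₀ w₀ 1 : ℂ) ≠ 0 := Circle.coe_ne_zero _
  field_simp
  ring

include hγH in
/-- **AT A FIXED PLACE `w ≠ w₀`**: `σ_w(t(ψ)) = −(u_w − z₀,w,0)(u_w − z₀,w,2)·(z₀,w,0 z₀,w,2)⁻¹` — constant. [cite: Rogawski1990, §4.9 p. 55] -/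
theorem evalC_archTauArg_centralCurve_of_ne (hc : ∀ w, w ≠ w₀ → c w = 0) (ψ : ℝ) {w : {w : InfinitePlace L // IsComplex w}} (hw : w ≠ w₀) :
    UnitaryGroup.evalC L w (archTauArg L (γH ψ)) = -(((z₀ w 1 : ℂ) - z₀ w 0) * ((z₀ w 1 : ℂ) - z₀ w 2)) * ((z₀ w 0 : ℂ) * z₀ w 2)⁻¹ := by
  rw [evalC_archTauArg_archSingularCurveH L z₀ c γH hγH ψ w, hc w hw]
  simp only [zero_mul, mul_zero, Circle.exp_zero, mul_one]

/-- `2cos x − 2 ≠ 0 ↔ cos x ≠ 1`. [folklore] -/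
private theorem two_mul_cos_sub_two_ne_zero_iff (x : ℝ) : 2 * (Real.cos x : ℂ) - 2 ≠ 0 ↔ Real.cos x ≠ 1 := by
  rw [not_iff_not]
  constructor
  · intro h
    have h1 : (Real.cos x : ℂ) = 1 := by linear_combination h / 2
    exact_mod_cast h1
  · intro h
    rw [h]
    push_cast
    ring

include hγH in
/-- **`t(ψ)` is a unit of `L ⊗ ℝ` iff `cos(c_{w₀}ψ) ≠ 1`** at the central base with `(G,H)`-regular fixed places (a CM field has no real place; every complex coordinate non-zero).
[cite: Rogawski1990, §4.9 p. 55] -/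
theorem isUnit_archTauArg_centralCurve_of_cos_ne_one (hc : ∀ w, w ≠ w₀ → c w = 0) (hcen : z₀ w₀ 0 = z₀ w₀ 1 ∧ z₀ w₀ 2 = z₀ w₀ 1)
    (hreg : ∀ w, w ≠ w₀ → z₀ w 1 ≠ z₀ w 0 ∧ z₀ w 1 ≠ z₀ w 2) {ψ : ℝ} (hψ : Real.cos (c w₀ * ψ) ≠ 1) :
    IsUnit (archTauArg L (γH ψ)) := by
  refine isUnit_archTauArg_of_isUnit L (γH ψ) (isUnit_mixedSpace_of_forall_evalC_ne_zero fun w => ?_)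
  by_cases hw : w = w₀
  · subst hw
    rw [evalC_eval_archCharpolyTwo_centralCurve_self L z₀ c γH hγH w hcen ψ]
    exact mul_ne_zero (pow_ne_zero _ (Circle.coe_ne_zero _)) (by
      have := (two_mul_cos_sub_two_ne_zero_iff (c w * ψ)).mpr hψ
      intro h0; apply this; linear_combination -h0)
  · rw [evalC_eval_archCharpolyTwo_centralCurve_of_ne L z₀ c γH hγH w₀ hc ψ hw]
    exact mul_ne_zero (sub_ne_zero.mpr fun h => (hreg w hw).1 (Circle.ext h)) (sub_ne_zero.mpr fun h => (hreg w hw).2 (Circle.ext h))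

/-! ## §2 `D_{G∕H,∞}` along the central curve -/

include hγH in
open scoped Classical in
/-- **`D_{G∕H,∞}(γ_H(ψ)) = K · (2 − 2cos(c_{w₀}ψ))`**, `K = ∏_{w ≠ w₀} ‖(u_w − z₀,w,0)(u_w − z₀,w,2)‖` (★ `archWeylRatio` = `∏_w |χ_g(u)_w|`; `|ζ²| = 1`, `2 − 2cos ≥ 0`).  So `D_{G∕H,∞}` vanishes to ORDER TWO
at the centre (`= 4K sin²(cψ∕2)`). [cite: Rogawski1990, §14.5 p. 238; §4.9 p. 55] -/
theorem archWeylRatio_centralCurve (hc : ∀ w, w ≠ w₀ → c w = 0) (hcen : z₀ w₀ 0 = z₀ w₀ 1 ∧ z₀ w₀ 2 = z₀ w₀ 1) (ψ : ℝ) :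
    archWeylRatio L (γH ψ) =
      (∏ w ∈ Finset.univ.erase w₀, ‖((z₀ w 1 : ℂ) - z₀ w 0) * ((z₀ w 1 : ℂ) - z₀ w 2)‖) * (2 - 2 * Real.cos (c w₀ * ψ)) := by
  unfold archWeylRatio
  rw [← Finset.prod_erase_mul _ _ (Finset.mem_univ w₀), evalC_eval_archCharpolyTwo_centralCurve_self L z₀ c γH hγH w₀ hcen ψ]
  congr 1
  · exact Finset.prod_congr rfl fun w hw => by rw [evalC_eval_archCharpolyTwo_centralCurve_of_ne L z₀ c γH hγH w₀ hc ψ (Finset.ne_of_mem_erase hw)]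
  · rw [norm_mul, norm_pow, Circle.norm_coe, one_pow, one_mul]
    have h : (2 - 2 * (Real.cos (c w₀ * ψ) : ℂ)) = ((2 - 2 * Real.cos (c w₀ * ψ) : ℝ) : ℂ) := by push_cast; ring
    rw [h, Complex.norm_real, Real.norm_of_nonneg]
    nlinarith [Real.cos_le_one (c w₀ * ψ)]

omit [IsCMField L] in
open scoped Classical in
/-- The constant `K = ∏_{w ≠ w₀} ‖(u_w − z₀,w,0)(u_w − z₀,w,2)‖` is POSITIVE under `(G,H)`-regularity at the fixed places. [cite: Rogawski1990, §4.9 p. 55] -/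
theorem prod_norm_centralCurve_pos (hreg : ∀ w, w ≠ w₀ → z₀ w 1 ≠ z₀ w 0 ∧ z₀ w 1 ≠ z₀ w 2) :
    0 < ∏ w ∈ Finset.univ.erase w₀, ‖((z₀ w 1 : ℂ) - z₀ w 0) * ((z₀ w 1 : ℂ) - z₀ w 2)‖ :=
  Finset.prod_pos fun w hw => norm_pos_iff.mpr (mul_ne_zero
    (sub_ne_zero.mpr fun h => (hreg w (Finset.ne_of_mem_erase hw)).1 (Circle.ext h))
    (sub_ne_zero.mpr fun h => (hreg w (Finset.ne_of_mem_erase hw)).2 (Circle.ext h)))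

/-! ## §3 `κ_w` along ★ B-p12's curve: explicit and independent of `ψ` (any base, any speeds) -/

include hγH hγG in
/-- **THE EIGENLINE PROJECTOR ON THE CURVE**: `P_w(γ_H(ψ), γ′(ψ)) = χ_{g_w}(γ′_w) = diag(0, (u_w − a_w)(u_w − b_w), 0)` — `γ′_w = diag(a_w, u_w, b_w)`, `tr g_w = a_w + b_w`, `det g_w = a_w b_w`
(★ `map_evalC_archSingularCurveG`, ★ `coe_map_evalC_fst_archSingularCurveH`); any base point, any speeds. [cite: Rogawski1990, §14.6 p. 242; §4.9 p. 55] -/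
theorem archEigenlineProjector_archSingularCurve (ψ : ℝ) (w : {w : InfinitePlace L // IsComplex w}) :
    archEigenlineProjector L (Matrix.diagonal α) (γH ψ) w (γG ψ) =
      Matrix.diagonal ![0, ((z₀ w 1 : ℂ) - ((z₀ w 0 * Circle.exp (![(1 : ℝ), 0, -1] 0 * (c w * ψ)) : Circle) : ℂ)) * ((z₀ w 1 : ℂ) - ((z₀ w 2 * Circle.exp (![(1 : ℝ), 0, -1] 2 * (c w * ψ)) : Circle) : ℂ)), 0] := by
  -- freeze the three diagonal entries as atoms
  set A : ℂ := ((z₀ w 0 * Circle.exp (![(1 : ℝ), 0, -1] 0 * (c w * ψ)) : Circle) : ℂ) with hA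
  set B : ℂ := ((z₀ w 2 * Circle.exp (![(1 : ℝ), 0, -1] 2 * (c w * ψ)) : Circle) : ℂ) with hB
  set U : ℂ := ((z₀ w 1 * Circle.exp (![(1 : ℝ), 0, -1] 1 * (c w * ψ)) : Circle) : ℂ) with hU
  have hU1 : U = (z₀ w 1 : ℂ) := by
    rw [hU]; simp only [Matrix.cons_val_one, Matrix.cons_val_zero, zero_mul, Circle.exp_zero, mul_one]
  -- the two matrices at `w`
  have hG : ((((γG ψ : ↥(UnitaryGroup.arch (↥(maximalRealSubfield L)) L (IsCMField.complexConj L) 3 (Matrix.diagonal α))) :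
        GL (Fin 3) (mixedEmbedding.mixedSpace L)) : Matrix (Fin 3) (Fin 3) (mixedEmbedding.mixedSpace L)).map (UnitaryGroup.evalC L w)) =
      Matrix.diagonal ![A, U, B] := by
    have h := congrArg (fun g : GL (Fin 3) ℂ => (g : Matrix (Fin 3) (Fin 3) ℂ)) (map_evalC_archSingularCurveG L α z₀ c γG hγG ψ w)
    rw [UnitaryGroup.coe_circleDiagonal] at h
    refine (Eq.trans rfl h : _).trans ?_
    congr 1
    funext i
    fin_cases i <;> rfl
  have hH := coe_map_evalC_fst_archSingularCurveH L z₀ c γH hγH ψ w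
  rw [← hA, ← hB] at hH
  unfold archEigenlineProjector
  simp only []
  rw [hG, hH, Matrix.trace_fin_two_of, Matrix.det_fin_two_of, ← hU1]
  ext i j
  fin_cases i <;> fin_cases j <;> simp [Matrix.mul_apply, Matrix.diagonal] <;> ring

/-- `sgn(|q|²·r) = sgn r` for `q ≠ 0`. [folklore] -/
private theorem sign_normSq_mul {q : ℂ} (hq : q ≠ 0) (r : ℝ) : SignType.sign (Complex.normSq q * r) = SignType.sign r := by
  rw [sign_mul, (sign_pos (Complex.normSq_pos.mpr hq) : SignType.sign (Complex.normSq q) = 1), one_mul]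

include hγH hγG in
/-- **`κ_w` ON THE CURVE IS EXPLICIT AND DOES NOT DEPEND ON `ψ`**: whenever `(u_w − a_w(ψ))(u_w − b_w(ψ)) ≠ 0`,
`κ_w(γ_H(ψ), γ′(ψ)) = sgn(re σ_w(α 1)) · η_w(diag α)` — the sign of the form on the MIDDLE coordinate line (the `u`-eigenline of `γ′_w = diag(a,u,b)`) relative to the majority sign
(`tr(Pᴴ σ_w(diag α) P) = |(u−a)(u−b)|² σ_w(α 1)`).  Any base, any speeds; in particular `κ` NEVER JUMPS along these curves (cf. ★ `eventually_prod_archKappaAt_archSingularCurve_eq`).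
[cite: Rogawski1990, §14.6 p. 242] [cite: LanglandsShelstad1987, §2, Lemma 4.1.A] -/
theorem archKappaAt_archSingularCurve_eq_of_ne_zero (ψ : ℝ) (w : {w : InfinitePlace L // IsComplex w})
    (hq : ((z₀ w 1 : ℂ) - ((z₀ w 0 * Circle.exp (![(1 : ℝ), 0, -1] 0 * (c w * ψ)) : Circle) : ℂ)) * ((z₀ w 1 : ℂ) - ((z₀ w 2 * Circle.exp (![(1 : ℝ), 0, -1] 2 * (c w * ψ)) : Circle) : ℂ)) ≠ 0) :
    archKappaAt L (Matrix.diagonal α) (γH ψ) w (γG ψ) = (SignType.sign ((w.1.embedding (α 1)).re) : ℤ) * archMajoritySign L (Matrix.diagonal α) w := by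
  unfold archKappaAt
  rw [archEigenlineProjector_archSingularCurve L α z₀ c γH γG hγH hγG ψ w]
  set q : ℂ := ((z₀ w 1 : ℂ) - ((z₀ w 0 * Circle.exp (![(1 : ℝ), 0, -1] 0 * (c w * ψ)) : Circle) : ℂ)) * ((z₀ w 1 : ℂ) - ((z₀ w 2 * Circle.exp (![(1 : ℝ), 0, -1] 2 * (c w * ψ)) : Circle) : ℂ)) with hqdef
  rw [Matrix.diagonal_map (map_zero _), Matrix.diagonal_conjTranspose, Matrix.diagonal_mul_diagonal, Matrix.diagonal_mul_diagonal, Matrix.trace_diagonal]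
  congr 2
  simp only [Fin.sum_univ_three, Matrix.cons_val_zero, Matrix.cons_val_one, Matrix.cons_val_two, Matrix.tail_cons, Matrix.head_cons, Pi.star_apply,
    star_zero, zero_mul, mul_zero, zero_add, add_zero]
  -- `re (conj q * h * q) = normSq q * re h`
  have h : star q * w.1.embedding (α 1) * q = w.1.embedding (α 1) * (Complex.normSq q : ℂ) := by
    rw [Complex.star_def, ← Complex.mul_conj]
    ring
  rw [h, mul_comm, Complex.re_ofReal_mul, sign_normSq_mul hq]

include hγH hγG in
open scoped Classical in
/-- **AT THE CENTRAL BASE: `∏_w κ_w(γ_H(ψ), γ′(ψ)) = ∏_w sgn(re σ_w(α 1))·η_w` for EVERY `ψ` with `cos(c_{w₀}ψ) ≠ 1`** (at `w₀`: `(u−a)(u−b) = ζ²(2−2cos cψ) ≠ 0`; at `w ≠ w₀`: the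
`(G,H)`-regular constants) — a constant in `{±1}`-valued bookkeeping (each factor `≠ 0` iff `re σ_w(α 1) ≠ 0`); at `ψ = 0` itself `κ_{w₀} = 0` since `P_{w₀}(0) = 0`.
[cite: Rogawski1990, §14.6 p. 242; §14.5 p. 238] -/
theorem prod_archKappaAt_centralCurve_eq_of_cos_ne_one (hc : ∀ w, w ≠ w₀ → c w = 0) (hcen : z₀ w₀ 0 = z₀ w₀ 1 ∧ z₀ w₀ 2 = z₀ w₀ 1)
    (hreg : ∀ w, w ≠ w₀ → z₀ w 1 ≠ z₀ w 0 ∧ z₀ w 1 ≠ z₀ w 2) {ψ : ℝ} (hψ : Real.cos (c w₀ * ψ) ≠ 1) :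
    (∏ w : {w : InfinitePlace L // IsComplex w}, archKappaAt L (Matrix.diagonal α) (γH ψ) w (γG ψ)) =
      ∏ w : {w : InfinitePlace L // IsComplex w}, ((SignType.sign ((w.1.embedding (α 1)).re) : ℤ) * archMajoritySign L (Matrix.diagonal α) w) := by
  refine Finset.prod_congr rfl fun w _ => archKappaAt_archSingularCurve_eq_of_ne_zero L α z₀ c γH γG hγH hγG ψ w ?_
  -- the non-vanishing of `(u_w − a_w)(u_w − b_w)`, read off §1 through ★ `evalC_eval_archCharpolyTwo_archSingularCurveH`
  rw [← evalC_eval_archCharpolyTwo_archSingularCurveH L z₀ c γH hγH ψ w]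
  by_cases hw : w = w₀
  · subst hw
    rw [evalC_eval_archCharpolyTwo_centralCurve_self L z₀ c γH hγH w hcen ψ]
    exact mul_ne_zero (pow_ne_zero _ (Circle.coe_ne_zero _)) (by
      have := (two_mul_cos_sub_two_ne_zero_iff (c w * ψ)).mpr hψ
      intro h0; apply this; linear_combination -h0)
  · rw [evalC_eval_archCharpolyTwo_centralCurve_of_ne L z₀ c γH hγH w₀ hc ψ hw]
    exact mul_ne_zero (sub_ne_zero.mpr fun h => (hreg w hw).1 (Circle.ext h)) (sub_ne_zero.mpr fun h => (hreg w hw).2 (Circle.ext h))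

end Curve

end Literature.NumberTheory.Rogawski1990

end
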